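import Literature.NumberTheory.EllipticCurves.Castella2018.ErratumHidaMembersCongruenceTorsionFree
import Literature.NumberTheory.EllipticCurves.SkinnerUrban2014.GL2MainConjecture
import Literature.NumberTheory.EllipticCurves.BDPAnticyclotomicPAdicLFunctionSigmaInt
import HarnessLib

/-!
# Castella's erratum, Theorem 2.3, the «⊂» half (2.5) — `Ch_{Λ_𝒪}(X^Σ_ac(A_g))Λ_𝒪^ur ⊂ (L^Σ_p(g))` for ONE `p`-ordinary
# CRYSTALLINE newform `g` over `K` [⟸ Fouquet–Wan, Thm. 4.41 — UNREFEREED] — as an OPEN hypothesis on ONE newform,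
# read in the receptacle `𝓞_{ℂ_p}⟦T⟧` (the isolated unrefereed input of K2's member package)

Cell `bsd-stepL` (run/shared/lean/pub/bsd-stepL/), seat `bsd-stepL-imc-p1` (prover g15, 2026-08-28); design memo
`HOME/imc-p1/g15/FSPLIT-DESIGN-20529-imc-p1-g15.md` (evidence on item stmt-BirchSwinnertonDyer-20529), fact F4♯. ONE new named `Prop`
(D-0014: +1 unproved, claim-tagged, OPEN); no definition besides the `Prop`, no instance, no `sorry`.

## Why this file exists (and how it relates to O14 ∕ O15)

The tree's OPEN input of the K2 Road FF is the erratum's MEMBER PACKAGE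
`Castella2018.erratum_members_exists_charIdeal_le_of_isTorsion_congruence_OPEN` (O15; K2 crux `CastellaErratumMemberPackage`), which
bundles, for the Hida members `g_m` of `f_E`, three PUBLISHED ingredients (the frame of `f` [Cas18 Thm. 3.1], the members (a)(b)
[Ski16 §2.6], the congruence (c) [Cas20 Thm. 2.11]) with ONE unrefereed one: (2.5)_m, i.e. the erratum's Thm. 2.3 «⊂» for the member
`g_m` ⟸ [FW21, Thm. 4.41]. O15 had to keep `L^Σ_p(g_m)` EXISTENTIAL (flag `Mem-r3`) because no frame could host it. With the
Σ-imprimitive weight-`k` frame in `𝓞_{ℂ_p}⟦T⟧` (`IsBDPLFunctionWtSigmaInt`, file `BDPAnticyclotomicPAdicLFunctionSigmaInt.lean`) the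
unrefereed ingredient can be stated ALONE, for ONE newform `g`, with no elliptic curve, no members and no congruence: this file. The
published ingredients are the companion fact `Castella2018.erratum_exists_frames_members_sigma_congruence` (file
`ErratumHidaMembersFrames.lean`); the cell's kernel glue (`HOME/imc-p1/g15/FSplitScratch.lean`, farm-checked) derives the K2 crux
`IMCDivAtErratumDataAllR` from the two. HONEST FRAMING: an UNREFEREED claim enters the tree ONLY as an explicitly labelled OPEN hypothesis
(`def … _OPEN : Prop`, `[claim: …]`), never as a theorem; nothing about any form or curve is asserted.

## Source, verbatim

[Castella2018Erratum] (held text `paper:url-e83251f1873d`), §2 (p. 2): "let `g ∈ S_k(Γ₀(M))` be a `p`-ordinary newform of even weight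
`k ≥ 2` and level `M ≥ 3` with `p ∤ M` defined over `𝒪` … `A_g := V_g/T_g` … `M_g := T_g ⊗_𝒪 Λ_𝒪^*` … `Sel^Σ_𝔭(K, M_g)` following [Cas18,
Def. 2.2]." (p. 3): "Write `X^Σ_ac(A_g) = Sel^Σ_𝔭(K, M_g)^*` … Suppose now that in addition `K` satisfies the following Heegner hypothesis:
there exists an ideal `𝔐 ⊂ 𝒪_K` with `𝒪_K/𝔐 ≃ ℤ/Mℤ`. … put `Λ_𝒪^ur = Λ_{R₀} ⊗_{ℤ_p} 𝒪`. **Theorem 2.3.** Let `g ∈ S_k(Γ₀(M))` be a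
`p`-ordinary newform of weight `k ≥ 2` and level `M ≥ 3` with `p ∤ M`. Assume that: (i) `ρ̄_g|_{G_K}` is irreducible. (ii) If `2` is
nonsplit in `K`, then `2 ∥ M`. (iii) There is a prime `q ∥ M` which is nonsplit in `K`. (iv) If `ℓ ∥ M` is nonsplit in `K`, then the local
component `π(f)_ℓ` is the special representation twisted by the unramified character sending `ℓ ↦ −ℓ^{k/2−1}`. If `Σ` is any finite set
of primes `v ∤ p` of `K`, then `X^Σ_ac(A_g)` is `Λ_𝒪`-torsion, and `Ch_{Λ_𝒪}(X^Σ_ac(A_g))Λ_𝒪^ur = (L^Σ_p(g))`, where `L^Σ_p(g)` is as in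
[Cas18, (5.1)] [slip for (3.1): `L^Σ_p(f) := L_p(f) × ∏_{w∈Σ} P_w(…)`]." Proof, the «⊂» half (p. 4): "By [FW21, Thm. 4.41], we then have
the divisibility (2.4) `Ch_{Λ̃_𝒪}(X_K(A_g))Λ̃_𝒪^ur ⊂ (L^Gr_p(g))` … (Note that the proof of this integral divisibility uses the `µ = 0`
result of [Hsi14, Thm. B].) By [FO12, Cor. 7.2.1], `L^Gr_p(g)` agrees (up to a unit) with the product of a two-variable Hida `p`-adic Rankin
`L`-series, an anticyclotomic Katz `p`-adic `L`-function, and the class number of `K`. As a result, by the same calculation as in [CGS23,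
Prop. 1.4.5] … `L^{Gr,Σ}_p(g)_ac = L^Σ_p(g)` up to a `p`-adic unit. Taking a `Σ` that contains all primes dividing `M`, by [JSW17,
Cor. 3.4.2] it follows that (2.4) yields the divisibility **(2.5) `Ch_{Λ_𝒪}(X^Σ_ac(A_g))Λ_𝒪^ur ⊂ (L^Σ_p(g))`** in `Λ_𝒪^ur`." [Locator notes,
NOT part of the quote (cell LIT-DOSSIER §20.0 CORRECTION 2 ∕ §20.5): the erratum's «[FO12, Cor. 7.2.1]» refers to [FW21], App. B,
Cor. 7.21 with Lemma 7.22 — [FO12] = Fouquet–Ochiai has no §7 —, and «[CGS23, Prop. 1.4.5]» is the arXiv numbering of the published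
[CastellaGrossiSkinner2025, Prop. 2.4.5].] Footnote 1
(p. 4): "the hypothesis that `ρ̄_{g_m} ≃ E[p]` is irreducible as a `G_ℚ`-module and ramified at some prime `q ∥ N` nonsplit in `K` implies
that `ρ̄_{g_m}|_{G_K}` is irreducible, see [Ski20, Lem. 2.8.1]." [FouquetWan2021] Thm. 4.41 (arXiv:2107.13726 tex p0044 L73 – p0045 L12):
"Let `f ∈ S_k(Γ₀(N))` be an eigencuspform of even weight `k` … `ρ̄_f|G_𝒦` absolutely irreducible; `ρ_f|G_{ℚ_p}` crystalline, and
either `ρ̄_f|G_{ℚ_p}` absolutely irreducible or `f` ordinary at `p`; there exists `q ∥ N` not split in `𝒦`; if `ℓ ∣ N` is not split in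
`𝒦` then `ℓ ∥ N`, and if `2` is non-split then `2 ∥ N` … [and for the integral statement] if `ℓ ∣ N` is not split in `𝒦`, then `ℓ` is
ramified in `𝒦` and `π(f)_ℓ` is a special Steinberg representation twisted by `χ_ur`, `ℓ ↦ (−1)ℓ^{k/2−1}`. Then
`char_{𝒪^ur⟦Γ_𝒦⟧}(X^Gr_𝒦(f) ⊗_𝒪 𝒪^ur) ⊆ (𝓛^Gr_𝒦(f))` holds." [JetchevSkinnerWan2017] §5.1 (arXiv:1512.06894 tex p0022 L41–50): "`L^Σ_p(f) =
L_p(f) × ∏_{w∈Σ} P_w(ε⁻¹Ψ⁻¹(Frob_w))` … satisfies the interpolation formula … with `L(f,ψ^alg,1)` replaced with the incomplete `L`-value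
`L^Σ(f,ψ^alg,1)`."

## Transcription (tree vocabulary only; nothing re-declared)

`g : CuspForm (Gamma0 M) k` a newform (`IsNewform0 g`, `[NeZero M]`) of even weight `2 ≤ k`, `3 ≤ M`, `¬ p ∣ M`; ADDED hypothesis
`3 < p` (Thm. 1.1's `p > 3`, not restated by §2 ∕ Thm. 2.3 — an extra hypothesis only weakens the fact; flag `T23-p`); the coefficient
embedding `ι_g : coeffField g →+* ℚ̄_p` COMPATIBLE with the embedding datum `ι : ℚ̄_p ≃ ℂ` — `ι (ι_g x) = x` on `ℚ(g) ⊂ ℂ` — (print fixes ONE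
`ı_p`, §2 p. 2: "`g` … defined over `𝒪`", and `ρ_g`, `L^Σ_p(g)`, `𝔭` are all relative to it; without this binder the `Prop` would quantify over
Galois-conjugate data with a fixed frame and be STRONGER than print — flag `T23-compat`, reviewer of p590900), with `|ι_g(a_p(g))| = 1`
(`p`-ordinary), `Δ : OrdinaryNewformDatum g p ι_g`
(the lattice `T_g` with its ordinary line over `𝒪 = padicCoeffIntegers ι_g`, tree `GreenbergSelmerNewformDatum`); `K` imaginary
quadratic with the Heegner hypothesis for `M` (`∃ β, 4M ∣ β² − d_K`), `p` split, `𝔭 ∋ p` singled out by the embedding datum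
`ι : ℚ̄_p ≃ ℂ`, `𝔭bar ∋ p`, `𝔭bar ≠ 𝔭` (the Selmer slot, flag `T23-orient` = O15's `Mem-orient`); (i′) `ρ̄_g` irreducible
(`SkinnerUrban2014.IsResiduallyIrreducible Δ`) AND residually ramified (`SkinnerUrban2014.IsResiduallyRamifiedAt Δ v`) at a rational
prime `q ∥ M` non-split in `K` — footnote 1's sufficient condition for (i), flag `T23-footnote`; (ii) `2` non-split ⟹ `2 ∣ M ∧ ¬ 4 ∣ M`;
(iii)+(iv) every prime `ℓ ∣ M` non-split in `K` has `¬ ℓ² ∣ M` and `a_ℓ(g) = −ℓ^{k/2−1}` (the `U_ℓ`-eigenvalue of a newform special at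
`ℓ` twisted by the unramified character `ℓ ↦ −ℓ^{k/2−1}`); `κ` anticyclotomic with generator `γ`; `Σ = S` a finite set of places of `K`
with `p ∉ w` for `w ∈ S` and containing every `w ∋ M` ("taking a `Σ` that contains all primes dividing `M`"). CONCLUSION: for the
inclusion `b : 𝒪 → 𝓞_{ℂ_p}` (characterised: `b x = ι_g`-image of `x` in `ℂ_p`) and EVERY Σ-imprimitive frame of `g` in `𝓞_{ℂ_p}⟦T⟧` —
`Ω_K ≠ 0`, `Ω_p ∈ 𝓞_{ℂ_p}^×`, `Q` with `IsBDPLFunctionWtSigmaInt ι 𝔭 κ γ g S Ω_K Ω_p Q` — IF `X^Σ_ac(A_g) := XBig κ (Δ.cofreeRepOver K) 𝔭bar S`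
is `Λ_𝒪 = 𝒪⟦T⟧`-torsion THEN `Ch_{Λ_𝒪}(X^Σ_ac(A_g)) · 𝓞_{ℂ_p}⟦T⟧ ⊆ (Q)`, i.e. `(XBig.charIdeal …).map (PowerSeries.map b) ≤ Ideal.span {Q}`.

## Flags (each makes the `Prop` WEAKER than or equal to print, never stronger)

* `T23-compat`: the binder `∀ x, ι (ι_g x) = x` is print's "one fixed embedding `ı_p`"; it REMOVES the unintended strength of an
  uncorrelated pair `(ι_g, ι)` (the ideal `(L^Σ_p(g))` is not claimed Galois-stable by anyone).
* `T23-p`: `3 < p` is an ADDED hypothesis (Thm. 1.1's), harmless.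
* `T23-footnote`: (i) is taken in footnote 1's form (irreducible over `ℚ` + ramified at a `q ∥ M` non-split in `K`), which IMPLIES
  print's (i) [Ski20, Lem. 2.8.1]; the `Prop` is the corresponding special case. `-- TODO(general form): (i) ρ̄_g|_{G_K} irreducible`.
* `T23-receptacle`: print's `Λ_𝒪^ur = Λ_{R₀} ⊗ 𝒪`; here the inclusion is read in `𝓞_{ℂ_p}⟦T⟧ ⊇ (R₀·𝒪)⟦T⟧` along `b` — ideal inclusions map
  forward, so this is implied by print.
* `T23-frame-∀`: stated for EVERY `Q` with the interpolation property of `L^Σ_p(g)` (print: THE `L^Σ_p(g)`); the interpolation points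
  `φ̂(γ) − 1` lie in a closed disc of radius `< 1`, where a non-zero bounded series has finitely many zeros, so the frame is unique — a
  true, unformalised fact; same convention as every `∀`-frame statement of the cell (e.g. the H2 value facts).
* `T23-sigma-interp`: `L^Σ_p(g)` is characterised by interpolation of Σ-DEPLETED values ([JSW17, §5.1]) in D3's normalisation
  (`bdpInterpolationValueWtSigma`), rather than defined as `L_p(g)·∏P_w` ([Cas18, (3.1)]); the two agree in print. A unit discrepancy in
  the normalisation does not change the ideal `(Q)`.
* `T23-torsion-premise`: Thm. 2.3 prints torsion as a CONCLUSION (Heegner side, ARM-P GAP-β provenance); here it is a PREMISE (R-f), as in O15.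
* `T23-one-sided`: only «⊂» (the half resting on [FW21]) is transcribed.
* `T23-top`: for every topology on `Λ_𝒪` making the action continuous (the groups do not depend on it), as O15.
STATUS: **OPEN ∕ PRE** — rests on [FouquetWan2021, Thm. 4.41] with the erratum's «[FO12, Cor. 7.2.1]» (= [FW21] App. B Cor. 7.21 ∕
Lemma 7.22 per the cell's locator note) (arXiv:2107.13726, preprint), the weight-`k` analogue of the erratum's «[CGS23, Prop. 1.4.5]»
(= published Prop. 2.4.5; the weight-`k` computation is unprinted — part of the claim), [JSW17, Cor. 3.4.2], [Hsi14, Thm. B]; the erratum is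
unrefereed.
NEVER cite this `Prop` as a theorem; a result using it is CONDITIONAL.

## References

* [Castella2018Erratum] §2, Thm. 2.3, (2.4)–(2.5), footnote 1 (pp. 2–4). [Castella2024] arXiv:2409.01360 Thm. 3.1 (cites it).
* [FouquetWan2021] O. Fouquet, X. Wan, arXiv:2107.13726, Def. 4.39, Conj. 4.40, Thm. 4.41, Cor. 7.21, Lemma 7.22 (PREPRINT).
* [JetchevSkinnerWan2017] Camb. J. Math. 5 (2017), Cor. 3.4.2, proof of Thm. 6.1.6, §5.1 (`L^Σ_p`).
* [CastellaGrossiSkinner2025] Math. Ann. (2025), Prop. 2.4.5 (weight 2). [Hsieh2014] Doc. Math. 19, Thm. B. [Skinner2020] Lem. 2.8.1.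
* [Castella2018] Camb. J. Math. 6 (2018), Def. 2.2, Thm. 3.1, (3.1). Tree: `BDPAnticyclotomicPAdicLFunctionSigmaInt.lean` (D-a′),
  `Castella2018/ErratumHidaMembersCongruence(TorsionFree).lean` (O14 ∕ O15), `SkinnerUrban2014/GL2MainConjecture.lean` (residual predicates),
  `BigGaloisRepSelmer.lean` (`XBig`, `XBig.charIdeal`), `GreenbergSelmerNewformDatum.lean` (`OrdinaryNewformDatum`, `toPadicAlgCl`).
-/

noncomputable section

open scoped Classical

open PowerSeries NumberField IsDedekindDomain Field
  Literature.NumberTheory.EllipticCurves Literature.NumberTheory.EllipticCurves.ModularForms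
  Literature.NumberTheory.EllipticCurves.BigGaloisRep Literature.NumberTheory.EllipticCurves.GreenbergSelmer
  Literature.NumberTheory.GaloisRepresentations

namespace Literature.NumberTheory.EllipticCurves.Castella2018

/-- **OPEN HYPOTHESIS — Castella's erratum, Thm. 2.3, the «⊂» half (2.5), Σ-imprimitive, for ONE `p`-ordinary crystalline newform
`g ∈ S_k(Γ₀(M))` over `K`, read in `𝓞_{ℂ_p}⟦T⟧: `Ch_{Λ_𝒪}(X^Σ_ac(A_g))·𝓞_{ℂ_p}⟦T⟧ ⊆ (L^Σ_p(g))` for every Σ-imprimitive frame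
`L^Σ_p(g) = Q` of `g`, under the torsion premise** — the erratum's use of [FW21, Thm. 4.41] (UNREFEREED), isolated from the member
package. Binders, transcription and the flags `T23-compat`, `T23-p`, `T23-footnote`, `T23-receptacle`, `T23-frame-∀`, `T23-sigma-interp`,
`T23-torsion-premise`, `T23-one-sided`, `T23-top`: module docstring. NEVER cite this `Prop` as a theorem: take it as an explicit hypothesis; a result using
it is conditional on unrefereed claims.
-- TODO(general form): (i) as printed is «ρ̄_g|_{G_K} irreducible»; the receptacle in print is `Λ_𝒪^ur = Λ_{R₀} ⊗_{ℤ_p} 𝒪`.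
[claim: Castella2018Erratum, status: under-review]
[claim: FouquetWan2021, status: under-review]
[cite: JetchevSkinnerWan2017, Cor. 3.4.2, proof of Thm. 6.1.6 and §5.1 (the inputs of (2.4) ⇒ (2.5) and the Σ-imprimitive interpolation; shape)]
[cite: Castella2018, Def. 2.2, Thm. 3.1 and (3.1) (p. 9) (the objects `X^Σ_ac`, `L^Σ_p`; shape only, nothing asserted)] -/
def erratumThm23_charIdeal_sigma_le_of_isTorsion_OPEN : Prop :=
  ∀ {p : ℕ} [Fact p.Prime] (ι : PadicAlgCl p ≃+* ℂ) {M : ℕ} [NeZero M] {k : ℤ}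
    (g : CuspForm (CongruenceSubgroup.Gamma0 M) k) (ιg : coeffField g →+* PadicAlgCl p)
    (Δ : OrdinaryNewformDatum g p ιg)
    (K : Type) [Field K] [NumberField K] (𝔭 𝔭bar : HeightOneSpectrum (𝓞 K)) (κ : ZpExtension K p)
    (γ : absoluteGaloisGroup K) [Fact (κ.IsTopGenerator γ)] (S : Finset (HeightOneSpectrum (𝓞 K))),
    -- "`g ∈ S_k(Γ₀(M))` a `p`-ordinary newform of (even) weight `k ≥ 2` and level `M ≥ 3` with `p ∤ M`"; ADDED: `p > 3` (flag `T23-p`)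
    IsNewform0 g → 2 ≤ k → Even k → 3 ≤ M → ¬ p ∣ M → 3 < p →
    -- ONE embedding `ı_p` fixed once (§2, p. 2): the coefficient embedding `ι_g` IS `ι⁻¹` on `ℚ(g) ⊂ ℂ` ("`g` … defined over `𝒪`",
    -- `ρ_g`, `L^Σ_p(g)` and `𝔭` all relative to that `ı_p`; flag `T23-compat`), and `g` is `ı_p`-ordinary
    (∀ x : coeffField g, ι (ιg x) = (x : ℂ)) →
    ‖ιg ⟨(UpperHalfPlane.qExpansion 1 ⇑g).coeff p, coeff_mem_coeffField g p⟩‖ = 1 →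
    -- `K` imaginary quadratic, Heegner for `M`, `p` split, `𝔭` via `ι`, `𝔭bar ≠ 𝔭` the other prime above `p` (flag `T23-orient`)
    IsImaginaryQuadratic K → (∃ β : ℤ, (4 * M : ℤ) ∣ β ^ 2 - NumberField.discr K) →
    ((Ideal.span {(p : ℤ)}).primesOver (𝓞 K)).ncard = 2 →
    ((p : ℕ) : 𝓞 K) ∈ 𝔭.asIdeal →
    (∀ (w : InfinitePlace K) (x : 𝓞 K), x ∈ 𝔭.asIdeal ↔ ‖ι.symm (w.embedding (x : K))‖ < 1) →
    ((p : ℕ) : 𝓞 K) ∈ 𝔭bar.asIdeal → 𝔭bar ≠ 𝔭 →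
    -- (i′) `ρ̄_g` irreducible and ramified at some prime `q ∥ M` non-split in `K` (footnote 1 ⟹ (i); flag `T23-footnote`)
    SkinnerUrban2014.IsResiduallyIrreducible Δ →
    (∃ v : HeightOneSpectrum (𝓞 ℚ), SkinnerUrban2014.IsResiduallyRamifiedAt Δ v ∧
      ((Rat.HeightOneSpectrum.primesEquiv v : Nat.Primes) : ℕ) ∣ M ∧
      ¬ ((Rat.HeightOneSpectrum.primesEquiv v : Nat.Primes) : ℕ) ^ 2 ∣ M ∧
      ((Ideal.span {(((Rat.HeightOneSpectrum.primesEquiv v : Nat.Primes) : ℕ) : ℤ)}).primesOver (𝓞 K)).ncard ≠ 2) →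
    -- (ii) "if `2` is nonsplit in `K`, then `2 ∥ M`"
    (((Ideal.span {(2 : ℤ)}).primesOver (𝓞 K)).ncard ≠ 2 → (2 ∣ M ∧ ¬ 4 ∣ M)) →
    -- (iii)+(iv) every `ℓ ∣ M` non-split in `K`: `ℓ ∥ M` and `π(g)_ℓ` special ⊗ (`ℓ ↦ −ℓ^{k/2−1}`), i.e. `a_ℓ(g) = −ℓ^{k/2−1}`
    (∀ ℓ : ℕ, ℓ.Prime → ℓ ∣ M → ((Ideal.span {(ℓ : ℤ)}).primesOver (𝓞 K)).ncard ≠ 2 →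
      ¬ ℓ ^ 2 ∣ M ∧ (UpperHalfPlane.qExpansion 1 ⇑g).coeff ℓ = -((ℓ : ℂ) ^ (k / 2 - 1).toNat)) →
    -- `Γ` THE anticyclotomic `ℤ_p`-extension; `Σ` finite, away from `p`, containing the primes dividing `M`
    κ.IsAnticyclotomic → (∀ w ∈ S, ((p : ℕ) : 𝓞 K) ∉ w.asIdeal) →
    (∀ w : HeightOneSpectrum (𝓞 K), ((M : ℕ) : 𝓞 K) ∈ w.asIdeal → w ∈ S) →
    -- the inclusion `b : 𝒪 → 𝓞_{ℂ_p}` (characterised) and a Σ-imprimitive frame `(Ω_K, Ω_p, Q)` of `g` in `𝓞_{ℂ_p}⟦T⟧`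
    ∀ (b : padicCoeffIntegers ιg →+* PadicComplexInt p),
      (∀ x, ((b x : PadicComplexInt p) : ℂ_[p]) =
        algebraMap (PadicAlgCl p) ℂ_[p] (padicCoeffIntegers.toPadicAlgCl ιg x)) →
    ∀ (ΩK : ℂ) (Ωp : (PadicComplexInt p)ˣ) (Q : PowerSeries (PadicComplexInt p)), ΩK ≠ 0 →
      IsBDPLFunctionWtSigmaInt ι 𝔭 κ γ g S ΩK ((Ωp : PadicComplexInt p) : ℂ_[p]) Q →
      ∀ [TopologicalSpace (PowerSeries (padicCoeffIntegers ιg))]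
        [ContinuousSMul (PowerSeries (padicCoeffIntegers ιg))
          (BigRepModule (padicCoeffIntegers ιg) p (Cofree Δ.ρ (padicCoeffField ιg)))],
      -- premise (R-f): `X^Σ_ac(A_g)` is `Λ_𝒪`-torsion; conclusion (2.5): `Ch_{Λ_𝒪}(X^Σ_ac(A_g))·𝓞_{ℂ_p}⟦T⟧ ⊆ (Q)`
      Module.IsTorsion (PowerSeries (padicCoeffIntegers ιg)) (XBig κ (Δ.cofreeRepOver K) 𝔭bar (↑S)) →
      (XBig.charIdeal κ (Δ.cofreeRepOver K) 𝔭bar (↑S)).map (PowerSeries.map b) ≤ Ideal.span {Q}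

end Literature.NumberTheory.EllipticCurves.Castella2018

end
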